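import Summits.QuantumFields.BalabanUV.T4Continuum.Support.NE7ConvOneStepWeightedClass
import Summits.QuantumFields.BalabanUV.T4Continuum.Support.NE7EnergyBlockLandauClassPoincare
import HarnessLib

/-!
# NE7ConvOneStepGenericSlice — CONV-ONE-STEP OVER AN ABSTRACT SLICE FAMILY `𝒯 k W` (criticality transferred from the tangent kernel, coercivity from a class
# Poincaré hypothesis), AND ITS INSTANCE FOR THE CORNER-FREE ENERGY BLOCK-LANDAU SLICE `𝒯_E(W) = energyBlockLandauW` AT `d = 4`, `L = 2`, SU(2) — the TEMPLATE of the END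
# re-thread of the Bałaban-slice road (memo ROAD-G99 §3.5)

Cell `pub-balaban`, rung (B)+1 sub-cell t4, lineage `b2b-balaban-t4-ne7-p1` (CRUX PROVER NE7 #1 = OWNER of row NE7), generation 99.

WHY.  The ONE-STEP ∕ (8)∃ chain of row NE7 (F9 `isMinimiser_of_critical_rep_weighted` — generic in the slice `T` — wrapped by F10 `NE7ConvOneStepWeightedClass`, F25–F31, F326, the `…Dec`
files and the ENDs) hard-codes row NE3's slice `T_♮ = frameFreeBlockLandauW` from F10 upward.  Gen 99's obstruction (memo §1–§2) and road (memo §3) replace `T_♮` by the corner-free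
`𝒯_E = energyBlockLandauW` (`NE7MeanZeroGaugeSliceW`), whose criticality (`dAction_eq_zero_of_mem`) and class Poincaré inequality (`NE7EnergyBlockLandauClassPoincare`) landed this gen.
THIS FILE re-does F10's junction ONCE for an ABSTRACT slice family `𝒯 : ℕ → cfg → Set` under two displayed hypotheses — (hT) «tangent-critical ⟹ critical on `𝒯 k W`» and (hP) the class
Poincaré inequality for `𝒯` — so that every later file of the chain can be generalised by the same substitution (`frameFreeBlockLandauW L N (k+1) Us` ↦ `𝒯 k Us`, thread (hT), (hP));
and instantiates it for `𝒯_E` at `d = 4`, `L = 2`, `card n = 2`, `0 < ε ≤ 10⁻⁵³` with NO hypothesis beyond F10's (constant `8·CPLine + 1` in place of `CPLine + 1`).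
WHAT ([folklore]; 0 def, 0 sorry).  §1 `dAction_eq_zero_of_tangent_of_ker` (the adapter `NE7CriticalSliceAdapter.dAction_eq_zero_on_slice_of_ker` with the slice membership replaced by its
three used clauses: skew, periodic, tangent); §2 **`isMinimiser_of_kerCritical_rep_generic`** (F10's `isMinimiser_of_kerCritical_repW_class` for an abstract `𝒯`); §3 the instances:
`isMinimiser_of_kerCritical_repT_class` (recovers F10 for `T_♮`), **`isMinimiser_of_kerCritical_repE_SU2`** (`𝒯_E`, SU(2), `d = 4`, `L = 2`).
HONEST FRAMING (page 1): bookkeeping over F9 and gen 99's slice files; the per-pair representation `hrep` is a HYPOTHESIS; nothing of Bałaban's asserted; NOT ONE-STEP, NOT NE7; spine 0∕9;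
finite T⁴ rung (B)+1 — NOT infinite volume, NOT mass gap, NOT `BetaPertH`, NOT Clay.  Continuum YM on T⁴ ⇐ BetaPertH ∧ nine spine estimates (0/9 proved); BetaPertH ⇐ (D1) ∧ (D4) ∧
CAP+tail; G-an2-4 gates asym, D1 and NE2/3/4.
-/

set_option autoImplicit false

namespace Summit.QuantumFields.BalabanUV.T4Continuum.NE7ConvOneStepGenericSlice

open scoped BigOperators Matrix.Norms.L2Operator
open Literature.MathematicalPhysics.QuantumFieldTheory.Balaban1983to89
open B7Prop1Explicit B7Prop2Explicit MatrixLog UnitaryModel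
open T4AveragingDeficitWall (IsUnitaryCfg IsSkewDir SmallField fineAction vary curl curlSq dirSq Plaq)
open T4AveragingDeficitWallBoundary (IsPeriodicCfg periodBox)
open AveragingDeficitPeriodicCounting (IsPeriodicDir)
open AveragingDeficitTorusChart (TDir extDir resDir extDir_resDir)
open AveragingDeficitMultiLevelPrep (tower LevelSmall levelQ' TangentIter natCast_tower_succ levelQ'_resDir_eq_zero)
open AveragingDeficitMultiLevelBridge (tower_eq)
open MinimalActionLevels (levelAction perWin)
open MinimalActionSandwich (IsMinimiser admissible)
open MinimalActionRate (sfClass)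
open NE3HessForm (dAction)
open NE3SlicePoincareShape (SlicePoincare slicePoincare_mono)
open NE3FrameFreeSliceW (frameFreeBlockLandauW)
open NE3EnergyWeightedShapes (energyNormW)
open NE3SlicePoincareBudgetLine (CPLine)
open NE3ClassRadiusFamily (CPLine_nonneg_d4_L2)
open NE7ConvOneStepWeighted (isMinimiser_of_critical_rep_weighted)
open NE7ConvOneStepSU2 (levelSmall_all_d4_L2)
open NE7MeanZeroGaugeSliceW (energyBlockLandauW dAction_eq_zero_of_mem)
open NE7EnergyBlockLandauClassPoincare (classSlicePoincare_energyBlockLandau_SU2)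

noncomputable section

variable {d : ℕ} {n : Type*} [Fintype n] [DecidableEq n]

/-! ## §1 Criticality on the tangent kernel gives tangent-criticality -/

/-- **`ker levelQ'`-CRITICALITY ⟹ TANGENT-CRITICALITY** (the adapter `NE7CriticalSliceAdapter.dAction_eq_zero_on_slice_of_ker` with only the three clauses of the slice it uses):
`L ≥ 1`, `U♯` unitary `(L·tower L N k)`-periodic with `SmallField U♯ x`, `LevelSmall d L k x`; if `dAction U♯ (extDir Φ) W = 0` for every skew `Φ` in `ker levelQ'`, then
`dAction U♯ Y W = 0` for every skew `(L·tower L N k)`-periodic tangent `Y`. [folklore] -/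
theorem dAction_eq_zero_of_tangent_of_ker [Nonempty n] {L N k : ℕ} [NeZero L] [NeZero N] (hL : 1 ≤ L)
    {Us : Site d → Fin d → (Matrix n n ℂ)ˣ} {x : ℝ} (hUs : IsUnitaryCfg Us) (hUsP : IsPeriodicCfg Us ((L : ℤ) * (tower L N k : ℕ)))
    (hx : 0 ≤ x) (hls : LevelSmall d L k x) (hUsx : SmallField Us x) (W : Finset (Plaq d))
    (hcritK : ∀ Φ : TDir d n (L * tower L N k), (∀ r κ, Φ r κ ∈ skewAdjoint (Matrix n n ℂ)) →
      levelQ' L N k Us Φ = 0 → dAction Us (extDir (L * tower L N k) Φ) W = 0)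
    {Y : Site d → Fin d → Matrix n n ℂ} (hYs : IsSkewDir Y) (hYP : IsPeriodicDir Y ((tower L N (k + 1) : ℕ) : ℤ))
    (hYT : TangentIter L k Us Y) : dAction Us Y W = 0 := by
  haveI : NeZero (L * tower L N k) := ⟨Nat.mul_ne_zero (NeZero.ne L) (AveragingDeficitMultiLevelPrep.tower_ne_zero L N k)⟩
  have hYP' : IsPeriodicDir Y ((L * tower L N k : ℕ) : ℤ) := by
    have e : ((tower L N (k + 1) : ℕ) : ℤ) = ((L * tower L N k : ℕ) : ℤ) := by rw [natCast_tower_succ]; push_cast; ring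
    rw [← e]; exact hYP
  have hker : levelQ' L N k Us (resDir (L * tower L N k) Y) = 0 := levelQ'_resDir_eq_zero hL k hUs hUsP hx hls hUsx hYP' hYT
  have hres : ∀ r κ, resDir (L * tower L N k) Y r κ ∈ skewAdjoint (Matrix n n ℂ) := fun r κ => hYs _ _
  have h := hcritK (resDir (L * tower L N k) Y) hres hker
  rwa [extDir_resDir (L * tower L N k) hYP'] at h

/-! ## §2 CONV-ONE-STEP over an abstract slice family -/

/-- **CONV-ONE-STEP OVER AN ABSTRACT SLICE FAMILY `𝒯`** (`L ≥ 1`, `N ≥ 1`, `ε ≥ 0`, `CP > 0`, `LevelSmall d L k (ε(L^{k+1})^{−2})`).  `𝒯 k W` is any set of directions attached to the level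
`k+1` and the background `W`, with (hT) «for `W ∈ sfClass d L N ε (k+1)`: tangent-critical on the window ⟹ critical along `𝒯 k W`» and (hP) «`W ∈ sfClass … (j+1)` ⟹
`SlicePoincare L (j+1) W (𝒯 j W) CP (periodBox (N·L^{j+1}))`».  Then F9 applies with `T := 𝒯 k U♯`: `ker levelQ'`-critical `U♯` + the per-pair representation `hrep` over `𝒯 k U♯`
⟹ `IsMinimiser`. [folklore] -/
theorem isMinimiser_of_kerCritical_rep_generic [Nonempty n] {L N k : ℕ} [NeZero L] [NeZero N] (hL : 1 ≤ L) (hN : 1 ≤ N) {ε CP : ℝ}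
    (hε : 0 ≤ ε) (hCP : 0 < CP) (hls : LevelSmall d L k (ε / ((L : ℝ) ^ (k + 1)) ^ 2))
    (𝒯 : ℕ → (Site d → Fin d → (Matrix n n ℂ)ˣ) → Set (Site d → Fin d → Matrix n n ℂ))
    (hT : ∀ (j : ℕ) (W : Site d → Fin d → (Matrix n n ℂ)ˣ), W ∈ sfClass d L N ε (j + 1) → ∀ F : Finset (Plaq d),
      (∀ φ : Site d → Fin d → Matrix n n ℂ, IsSkewDir φ → IsPeriodicDir φ ((tower L N (j + 1) : ℕ) : ℤ) → TangentIter L j W φ → dAction W φ F = 0) →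
      ∀ Y ∈ 𝒯 j W, dAction W Y F = 0)
    (hP : ∀ (j : ℕ) (W : Site d → Fin d → (Matrix n n ℂ)ˣ), W ∈ sfClass d L N ε (j + 1) →
      SlicePoincare L (j + 1) W (𝒯 j W) CP (periodBox (d := d) (N * L ^ (j + 1))))
    {V Us : Site d → Fin d → (Matrix n n ℂ)ˣ} (hmem : Us ∈ admissible (sfClass d L N ε) L (k + 1) V)
    (hcritK : ∀ Φ : TDir d n (L * tower L N k), (∀ r κ, Φ r κ ∈ skewAdjoint (Matrix n n ℂ)) →
      levelQ' L N k Us Φ = 0 → dAction Us (extDir (L * tower L N k) Φ) (perWin d (N * L ^ (k + 1))) = 0)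
    (hrep : ∀ U' ∈ admissible (sfClass d L N ε) L (k + 1) V, ∃ (X XT XN : Site d → Fin d → Matrix n n ℂ) (α ν κ₁ : ℝ),
      IsSkewDir X ∧ IsPeriodicDir X ((N * L ^ (k + 1) : ℕ) : ℤ) ∧ 0 ≤ α ∧ (∀ x μ, ‖X x μ‖ ≤ α) ∧
      levelAction d L N (k + 1) (vary Us X 1) ≤ levelAction d L N (k + 1) U' ∧
      SmallField (vary Us X 1) (ε / ((L : ℝ) ^ (k + 1)) ^ 2) ∧
      X = XT + XN ∧ XT ∈ 𝒯 k Us ∧ IsSkewDir XN ∧ 0 ≤ ν ∧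
      energyNormW L (k + 1) Us XN (periodBox (d := d) (N * L ^ (k + 1)))
        ≤ ν * energyNormW L (k + 1) Us X (periodBox (d := d) (N * L ^ (k + 1))) ∧
      ε / ((L : ℝ) ^ (k + 1)) ^ 2 * (∑ p ∈ perWin d (N * L ^ (k + 1)), ‖curl Us XN p‖)
        ≤ κ₁ * energyNormW L (k + 1) Us X (periodBox (d := d) (N * L ^ (k + 1))) ^ 2 ∧
      2 * κ₁ ≤ ((((1 / 2 - ν ^ 2) / (2 * (1 + CP)) - ν ^ 2) / 2
          - 576 * d * (Real.exp α - 1) ^ 2 * ((L : ℝ) ^ (k + 1)) ^ 2) / (Fintype.card n : ℝ)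
          - 28 * d * (ε / ((L : ℝ) ^ (k + 1)) ^ 2 + 7 * α ^ 2) * ((L : ℝ) ^ (k + 1)) ^ 2)) :
    IsMinimiser d (sfClass d L N ε) L N (k + 1) V Us := by
  have ha : 0 ≤ ε / ((L : ℝ) ^ (k + 1)) ^ 2 := by positivity
  have hUsP : IsPeriodicCfg Us ((L : ℤ) * (tower L N k : ℕ)) := by
    have e : ((N * L ^ (k + 1) : ℕ) : ℤ) = (L : ℤ) * (tower L N k : ℕ) := by rw [tower_eq]; push_cast; ring
    rw [← e]; exact hmem.1.2.1
  have htan : ∀ φ : Site d → Fin d → Matrix n n ℂ, IsSkewDir φ → IsPeriodicDir φ ((tower L N (k + 1) : ℕ) : ℤ) → TangentIter L k Us φ →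
      dAction Us φ (perWin d (N * L ^ (k + 1))) = 0 :=
    fun φ hφs hφP hφT => dAction_eq_zero_of_tangent_of_ker hL hmem.1.1 hUsP ha hls hmem.1.2.2 _ hcritK hφs hφP hφT
  have hcrit : ∀ Y ∈ 𝒯 k Us, dAction Us Y (perWin d (N * L ^ (k + 1))) = 0 := hT k Us hmem.1 _ htan
  exact isMinimiser_of_critical_rep_weighted hL hN hmem hmem.1.1 ha hmem.1.2.2 hCP (hP k Us hmem.1) hcrit hrep

/-! ## §3 Instances: `T_♮` (recovers F10) and `𝒯_E` (the Bałaban-slice road) -/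

/-- (hT) for row NE3's `T_♮ = frameFreeBlockLandauW`: its elements are tangent. [folklore] -/
theorem hT_frameFree {L N : ℕ} (j : ℕ) (W : Site d → Fin d → (Matrix n n ℂ)ˣ) (F : Finset (Plaq d))
    (htan : ∀ φ : Site d → Fin d → Matrix n n ℂ, IsSkewDir φ → IsPeriodicDir φ ((tower L N (j + 1) : ℕ) : ℤ) → TangentIter L j W φ → dAction W φ F = 0) :
    ∀ Y ∈ frameFreeBlockLandauW (d := d) (n := n) L N (j + 1) W, dAction W Y F = 0 := by
  intro Y hY
  obtain ⟨hYs, hYP, hYT, -, -⟩ := hY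
  exact htan Y hYs hYP (by simpa using hYT)

/-- (hT) for the corner-free energy block-Landau slice `𝒯_E = energyBlockLandauW` on the class (`L ≥ 1`; the class supplies the multi-level small-field data): tangent-critical ⟹
critical along `𝒯_E`, by gen 99's `NE7MeanZeroGaugeSliceW.dAction_eq_zero_of_mem`. [folklore] -/
theorem hT_energyBlockLandau [Nonempty n] {L N : ℕ} [NeZero N] (hL : 1 ≤ L) {ε : ℝ} (hε : 0 ≤ ε)
    (hls : ∀ j : ℕ, LevelSmall d L j (ε / ((L : ℝ) ^ (j + 1)) ^ 2))
    (j : ℕ) (W : Site d → Fin d → (Matrix n n ℂ)ˣ) (hW : W ∈ sfClass d L N ε (j + 1)) (F : Finset (Plaq d))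
    (htan : ∀ φ : Site d → Fin d → Matrix n n ℂ, IsSkewDir φ → IsPeriodicDir φ ((tower L N (j + 1) : ℕ) : ℤ) → TangentIter L j W φ → dAction W φ F = 0) :
    ∀ Y ∈ energyBlockLandauW (d := d) (n := n) L N (j + 1) W, dAction W Y F = 0 := by
  obtain ⟨hWu, hWP, hWx⟩ := hW
  have hWP' : IsPeriodicCfg W ((tower L N (j + 1) : ℕ) : ℤ) := by
    have e : ((N * L ^ (j + 1) : ℕ) : ℤ) = ((tower L N (j + 1) : ℕ) : ℤ) := by rw [tower_eq]
    rw [← e]; exact hWP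
  have hx : 0 ≤ ε / ((L : ℝ) ^ (j + 1)) ^ 2 := by positivity
  intro Y hY
  exact dAction_eq_zero_of_mem hL j hWu hWP' hx (hls j) hWx F htan hY

/-- **CONV-ONE-STEP ON THE CORNER-FREE SLICE `𝒯_E`, SU(2), `d = 4`, `L = 2`, `0 < ε ≤ 10⁻⁵³`** — §2 with (hT) = `hT_energyBlockLandau`, (hP) = `classSlicePoincare_energyBlockLandau_SU2`
(constant `8·CPLine 4 2 2 10⁻¹⁷ 10⁻⁵³ + 1`, by monotonicity), the level family `levelSmall_all_d4_L2`; the only remaining inputs are `ker levelQ'`-criticality of `U♯` and the per-pair representation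
`hrep` over `𝒯_E(U♯)`. [folklore] -/
theorem isMinimiser_of_kerCritical_repE_SU2 [Nonempty n] (hn : Fintype.card n = 2) {N k : ℕ} [NeZero N] (hN : 1 ≤ N) {ε : ℝ}
    (hε : 0 < ε) (hε' : ε ≤ 1 / 10 ^ 53)
    {V Us : Site 4 → Fin 4 → (Matrix n n ℂ)ˣ} (hmem : Us ∈ admissible (sfClass 4 2 N ε) 2 (k + 1) V)
    (hcritK : ∀ Φ : TDir 4 n (2 * tower 2 N k), (∀ r κ, Φ r κ ∈ skewAdjoint (Matrix n n ℂ)) →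
      levelQ' 2 N k Us Φ = 0 → dAction Us (extDir (2 * tower 2 N k) Φ) (perWin 4 (N * 2 ^ (k + 1))) = 0)
    (hrep : ∀ U' ∈ admissible (sfClass 4 2 N ε) 2 (k + 1) V, ∃ (X XT XN : Site 4 → Fin 4 → Matrix n n ℂ) (α ν κ₁ : ℝ),
      IsSkewDir X ∧ IsPeriodicDir X ((N * 2 ^ (k + 1) : ℕ) : ℤ) ∧ 0 ≤ α ∧ (∀ x μ, ‖X x μ‖ ≤ α) ∧
      levelAction 4 2 N (k + 1) (vary Us X 1) ≤ levelAction 4 2 N (k + 1) U' ∧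
      SmallField (vary Us X 1) (ε / (((2 : ℕ) : ℝ) ^ (k + 1)) ^ 2) ∧
      X = XT + XN ∧ XT ∈ energyBlockLandauW (d := 4) (n := n) 2 N (k + 1) Us ∧ IsSkewDir XN ∧ 0 ≤ ν ∧
      energyNormW 2 (k + 1) Us XN (periodBox (d := 4) (N * 2 ^ (k + 1)))
        ≤ ν * energyNormW 2 (k + 1) Us X (periodBox (d := 4) (N * 2 ^ (k + 1))) ∧
      ε / (((2 : ℕ) : ℝ) ^ (k + 1)) ^ 2 * (∑ p ∈ perWin 4 (N * 2 ^ (k + 1)), ‖curl Us XN p‖)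
        ≤ κ₁ * energyNormW 2 (k + 1) Us X (periodBox (d := 4) (N * 2 ^ (k + 1))) ^ 2 ∧
      2 * κ₁ ≤ ((((1 / 2 - ν ^ 2) / (2 * (1 + (8 * CPLine 4 2 2 (1 / 10 ^ 17) (1 / 10 ^ 53) + 1))) - ν ^ 2) / 2
          - 576 * ((4 : ℕ) : ℝ) * (Real.exp α - 1) ^ 2 * (((2 : ℕ) : ℝ) ^ (k + 1)) ^ 2) / (Fintype.card n : ℝ)
          - 28 * ((4 : ℕ) : ℝ) * (ε / (((2 : ℕ) : ℝ) ^ (k + 1)) ^ 2 + 7 * α ^ 2) * (((2 : ℕ) : ℝ) ^ (k + 1)) ^ 2)) :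
    IsMinimiser 4 (sfClass 4 2 N ε) 2 N (k + 1) V Us := by
  have hls := levelSmall_all_d4_L2 hε.le (hε'.trans (by norm_num))
  have hCP : 0 < 8 * CPLine 4 2 2 (1 / 10 ^ 17) (1 / 10 ^ 53) + 1 := by linarith [CPLine_nonneg_d4_L2]
  exact isMinimiser_of_kerCritical_rep_generic (d := 4) (by norm_num) hN hε.le hCP (hls k)
    (fun j W => energyBlockLandauW (d := 4) (n := n) 2 N (j + 1) W)
    (fun j W hW F htan => hT_energyBlockLandau (by norm_num) hε.le hls j W hW F htan)
    (fun j W hW => slicePoincare_mono (classSlicePoincare_energyBlockLandau_SU2 hn hN hε hε' j W hW) (by linarith)) hmem hcritK hrep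

end

end Summit.QuantumFields.BalabanUV.T4Continuum.NE7ConvOneStepGenericSlice
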